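import Literature.Analysis.ValidatedNumerics.EllipticKTable
import Literature.Analysis.ValidatedNumerics.FixedPointInterval
import HarnessLib

/-!
# K-table look-up in the kernel fixed-point interval kit

Topic `Literature/Analysis/ValidatedNumerics`. The bridge between the certified K-table
(`EllipticKTable.lean`: rational rows and cell envelopes of `K = ellipticK`) and the kernel-evaluable
fixed-point intervals `FI` at scale `2^48` (`FixedPointInterval.lean`): the value and derivative
look-ups of `K` over a parameter interval, returned as `FI`s with inclusion theorems — the `K` atom
of fixed-point mean-value quadrature forms (Brent–Zimmermann §4.8 table look-up; outward rounding
of the rational envelope to the binary grid, Moore–Kearfott–Cloud §7).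

* `KTable.lookupFI t i p q` / `KTable.mem_lookupFI` — `K(u) ∈ lookupFI` for `u ∈ [p, q]` in cell `i`;
* `KTable.derivFI t i` / `KTable.mem_derivFI` — `K'(u) ∈ derivFI` on cell `i`;
* `KTable.lookupOfFI t i J` / `KTable.mem_lookupOfFI` — the same keyed by an `FI` enclosure `J` of
  the parameter (`p = J.lo/2^48`, `q = J.hi/2^48`).

## References
* [BrentZimmermann2010] R. P. Brent, P. Zimmermann, *Modern Computer Arithmetic*, CUP (2010), §4.8.
* [MooreKearfottCloud2009] R. E. Moore, R. B. Kearfott, M. J. Cloud, *Introduction to Interval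
  Analysis*, SIAM (2009), §7.
-/

noncomputable section

open Literature.Probability.RandomPlanarGeometry Literature.Analysis.ValidatedNumerics.Numerics

namespace Literature.Analysis.ValidatedNumerics

namespace KTable

variable {t : KTable}

/-- Outward rounding of a rational envelope `[lo, hi]` to the `2^48` grid.
[cite: MooreKearfottCloud2009, §7] -/
def roundFI (lo hi : ℚ) : FI := ⟨⌊lo * (SC : ℚ)⌋, ⌈hi * (SC : ℚ)⌉⟩

/-- Soundness of the outward rounding. [cite: MooreKearfottCloud2009, §7] -/
theorem mem_roundFI {lo hi : ℚ} {x : ℝ} (h1 : ((lo : ℚ) : ℝ) ≤ x) (h2 : x ≤ ((hi : ℚ) : ℝ)) :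
    FI.mem x (roundFI lo hi) := by
  have hS : (0 : ℝ) < SC := SC_pos
  constructor
  · have hf : ((⌊lo * (SC : ℚ)⌋ : ℤ) : ℝ) ≤ ((lo * (SC : ℚ) : ℚ) : ℝ) := by
      exact_mod_cast Int.floor_le (lo * (SC : ℚ))
    simp only [roundFI]
    refine hf.trans ?_
    push_cast
    exact mul_le_mul_of_nonneg_right h1 hS.le
  · have hc : ((hi * (SC : ℚ) : ℚ) : ℝ) ≤ ((⌈hi * (SC : ℚ)⌉ : ℤ) : ℝ) := by
      exact_mod_cast Int.le_ceil (hi * (SC : ℚ))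
    simp only [roundFI]
    refine le_trans ?_ hc
    push_cast
    exact mul_le_mul_of_nonneg_right h2 hS.le

/-- **Value look-up**: the `FI` `[⌊lo_i·2^48⌋, ⌈max(chord_i p, chord_i q)·2^48⌉]` for a look-up
interval `[p, q]` in cell `i`. [cite: BrentZimmermann2010, §4.8] -/
def lookupFI (t : KTable) (i : ℕ) (p q : ℚ) : FI :=
  roundFI (t.row i).lo (max (t.chord i p) (t.chord i q))

/-- **Soundness of the value look-up**: `K(u) ∈ lookupFI t i p q` for `u ∈ [p, q]`, given
`t.check` and `t.cellOK i p q`. [cite: BrentZimmermann2010, §4.8] -/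
theorem mem_lookupFI (h : t.check = true) {i : ℕ} {p q : ℚ} (hc : t.cellOK i p q = true) {u : ℝ}
    (hpu : (p : ℝ) ≤ u) (huq : u ≤ (q : ℝ)) : FI.mem (ellipticK u) (t.lookupFI i p q) := by
  have hs := cell_sound h hc hpu huq
  refine mem_roundFI hs.1 ?_
  push_cast
  exact hs.2

/-- **Derivative look-up**: the `FI` `[⌊slo_i·2^48⌋, ⌈shi_i·2^48⌉]` of cell `i`.
[cite: BrentZimmermann2010, §4.8] -/
def derivFI (t : KTable) (i : ℕ) : FI := roundFI (t.slopeLo i) (t.slopeHi i)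

/-- **Soundness of the derivative look-up**: `K'(u) ∈ derivFI t i` for `u ∈ [p, q]`, given
`t.check`, `t.cellOK i p q`, `1 ≤ i`, `i + 2 < n`. [cite: BrentZimmermann2010, §4.8] -/
theorem mem_derivFI (h : t.check = true) {i : ℕ} {p q : ℚ} (hc : t.cellOK i p q = true)
    (h1 : 1 ≤ i) (hi2 : i + 2 < t.size) {u : ℝ} (hpu : (p : ℝ) ≤ u) (huq : u ≤ (q : ℝ)) :
    FI.mem (deriv ellipticK u) (t.derivFI i) := by
  have hs := cell_sound_deriv h hc h1 hi2 hpu huq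
  exact mem_roundFI hs.1 hs.2

/-- The rational endpoints of an `FI`. [cite: MooreKearfottCloud2009, §7] -/
def loQ (J : FI) : ℚ := (J.lo : ℚ) / (SC : ℚ)

/-- The rational endpoints of an `FI`. [cite: MooreKearfottCloud2009, §7] -/
def hiQ (J : FI) : ℚ := (J.hi : ℚ) / (SC : ℚ)

/-- An `FI` member lies between the rational endpoints. [cite: MooreKearfottCloud2009, §7] -/
theorem loQ_le_of_mem {J : FI} {x : ℝ} (hx : FI.mem x J) :
    ((loQ J : ℚ) : ℝ) ≤ x ∧ x ≤ ((hiQ J : ℚ) : ℝ) := by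
  have hS : (0 : ℝ) < SC := SC_pos
  simp only [loQ, hiQ]
  push_cast
  exact ⟨(div_le_iff₀ hS).2 hx.1, (le_div_iff₀ hS).2 hx.2⟩

/-- **Value look-up keyed by an `FI`** enclosure `J` of the parameter. [cite: BrentZimmermann2010, §4.8] -/
def lookupOfFI (t : KTable) (i : ℕ) (J : FI) : FI := t.lookupFI i (loQ J) (hiQ J)

/-- Soundness: `m ∈ J`, `t.cellOK i (loQ J) (hiQ J)` ⟹ `K(m) ∈ lookupOfFI t i J`.
[cite: BrentZimmermann2010, §4.8] -/
theorem mem_lookupOfFI (h : t.check = true) {i : ℕ} {J : FI} {m : ℝ} (hm : FI.mem m J)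
    (hc : t.cellOK i (loQ J) (hiQ J) = true) : FI.mem (ellipticK m) (t.lookupOfFI i J) :=
  mem_lookupFI h hc (loQ_le_of_mem hm).1 (loQ_le_of_mem hm).2

/-- **Derivative look-up keyed by an `FI`**: `m ∈ J` ⟹ `K'(m) ∈ derivFI t i`.
[cite: BrentZimmermann2010, §4.8] -/
theorem mem_derivFI_of_mem (h : t.check = true) {i : ℕ} {J : FI} {m : ℝ} (hm : FI.mem m J)
    (hc : t.cellOK i (loQ J) (hiQ J) = true) (h1 : 1 ≤ i) (hi2 : i + 2 < t.size) :
    FI.mem (deriv ellipticK m) (t.derivFI i) :=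
  mem_derivFI h hc h1 hi2 (loQ_le_of_mem hm).1 (loQ_le_of_mem hm).2

/-- Worked look-up on the table `kTableQuarter`: the `FI` of `K` over `[3/10, 2/5]` (cell `1`) is
`[⌊1.68575…·2^48⌋, ⌈1.78674…·2^48⌉]` (kernel decision). [cite: BrentZimmermann2010, §4.8] -/
theorem lookupFI_example :
    kTableQuarter.lookupFI 1 (3 / 10) (2 / 5) = ⟨474496541159364, 502923993909495⟩ := by
  decide +kernel

end KTable

end Literature.Analysis.ValidatedNumerics

end
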